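import Mathlib

/-!
# Level-0 pairing bound of the relative-energy method (pointwise real inequality)

Helper file for the line `log-lipschitz-budget` of the crux
`ImplosionDichotomy.PolynomialCompression` (stub `stub_logBudgetShadowing`, blueprint §3).
At one point let `(a, w, b) = (ρ − ρ₁, u − u₁, θ − θ₁)` be the difference between a
hard-sphere–Euler state and the Type-I reference profile (`ρ₁ = c₁³`, `θ₁ = K c₁²`, gradients
`|du₁|, |dc₁| ≤ C/λ`), with equation-of-state values `|ζ0 − 1|, |ζ1| ≤ c_Z ρ σ³`,
`ρσ³(c_Z + 1) ≤ 1/8`. The pairing of `(A a, ρ w, B b)`, `A = θ(ζ0+ζ1)/ρ`, `B = 3ρ/(2θ)`, with the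
right-hand sides of the difference system is `≤ (Λ/λ) e + Γ σ³ (1 + c₁)⁸/λ · √e`,
`e = ½ (A a² + ρ|w|² + B b²)`, `Λ = C (94 + 78K)`, `Γ = C c_Z (59K + 8)`
(`level0_pairing_pointwise_bound`): quadratic terms are Type I, cross terms are absorbed by
AM–GM, the terms carrying `ζ0 − 1` or `ζ0 + ζ1 − 1` are `σ³`-small forcings. No torus, no PDE.
-/

namespace Summit.AtomisticToContinuum.HydrodynamicLimit.Theorems

/-- AM–GM absorption of a cross term `κ x y` into `L · ½ (P x² + Q y²)` when `κ² ≤ L² P Q`. -/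
private lemma cross_le {P Q L κ x y : ℝ} (hP : 0 < P) (hL : 0 ≤ L)
    (hκ : κ ^ 2 ≤ L ^ 2 * P * Q) : κ * x * y ≤ L * (1 / 2 * (P * x ^ 2 + Q * y ^ 2)) := by
  rcases hL.eq_or_lt with hL0 | hLpos
  · have hκ0 : κ = 0 := by
      rw [← hL0] at hκ
      nlinarith [sq_nonneg κ]
    simp [hκ0, ← hL0]
  · have key : 0 ≤ (L * P * x - κ * y) ^ 2 + (L ^ 2 * P * Q - κ ^ 2) * y ^ 2 := by
      linarith [sq_nonneg (L * P * x - κ * y), mul_nonneg (sub_nonneg.2 hκ) (sq_nonneg y)]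
    have hLP : 0 < L * P := mul_pos hLpos hP
    have hid : (L * P) * (2 * (L * (1 / 2 * (P * x ^ 2 + Q * y ^ 2)) - κ * x * y))
        = (L * P * x - κ * y) ^ 2 + (L ^ 2 * P * Q - κ ^ 2) * y ^ 2 := by ring
    have h3 : 0 ≤ 2 * (L * (1 / 2 * (P * x ^ 2 + Q * y ^ 2)) - κ * x * y) := by
      refine (mul_nonneg_iff_of_pos_left hLP).1 ?_
      rw [hid]; exact key
    linarith

/-- Sum of three cross terms `κᵢ x yᵢ` absorbed by the energy `E ≥ ½ (P x² + Q Σ yᵢ²)`. -/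
private lemma cross_sum_le {P Q L E x : ℝ} {κ y : Fin 3 → ℝ} (hP : 0 < P) (hQ : 0 < Q)
    (hL : 0 ≤ L) (hκ : ∀ i, κ i ^ 2 ≤ L ^ 2 * P * Q) (hEx : P * x ^ 2 ≤ 2 * E)
    (hExy : P * x ^ 2 + Q * (y 0 ^ 2 + y 1 ^ 2 + y 2 ^ 2) ≤ 2 * E) :
    κ 0 * x * y 0 + κ 1 * x * y 1 + κ 2 * x * y 2 ≤ 3 * L * E := by
  have h0 := cross_le (x := x) (y := y 0) hP hL (hκ 0)
  have h1 := cross_le (x := x) (y := y 1) hP hL (hκ 1)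
  have h2 := cross_le (x := x) (y := y 2) hP hL (hκ 2)
  have hQ' : 0 ≤ Q * (y 0 ^ 2 + y 1 ^ 2 + y 2 ^ 2) := by positivity
  have hsum : 1 / 2 * (P * x ^ 2 + Q * y 0 ^ 2) + 1 / 2 * (P * x ^ 2 + Q * y 1 ^ 2)
      + 1 / 2 * (P * x ^ 2 + Q * y 2 ^ 2) ≤ 3 * E := by linarith
  have h3 := mul_le_mul_of_nonneg_left hsum hL
  linarith

/-- A `σ³`-small forcing `F x` is bounded by `M √E` when `Q x² ≤ 2E` and `2F² ≤ Q M²`. -/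
private lemma forcing_le {F x Q E M : ℝ} (hQ : 0 < Q) (hM : 0 ≤ M)
    (hx : Q * x ^ 2 ≤ 2 * E) (hF : 2 * F ^ 2 ≤ Q * M ^ 2) : F * x ≤ M * Real.sqrt E := by
  have hE : 0 ≤ E := by nlinarith [mul_nonneg hQ.le (sq_nonneg x)]
  have h1 : (F * x) ^ 2 ≤ M ^ 2 * E := by
    refine le_of_mul_le_mul_left ?_ hQ
    calc Q * (F * x) ^ 2 = F ^ 2 * (Q * x ^ 2) := by ring
      _ ≤ F ^ 2 * (2 * E) := by gcongr
      _ = 2 * F ^ 2 * E := by ring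
      _ ≤ Q * M ^ 2 * E := by gcongr
      _ = Q * (M ^ 2 * E) := by ring
  calc F * x ≤ |F * x| := le_abs_self _
    _ ≤ Real.sqrt (M ^ 2 * E) := Real.abs_le_sqrt h1
    _ = M * Real.sqrt E := by rw [Real.sqrt_mul (sq_nonneg M), Real.sqrt_sq hM]

/-- Sum of three forcings `Fᵢ yᵢ` against the kinetic part of the energy. -/
private lemma forcing_sum_le {Q E M : ℝ} {F y : Fin 3 → ℝ} (hQ : 0 < Q) (hM : 0 ≤ M)
    (hy0 : Q * y 0 ^ 2 ≤ 2 * E) (hy1 : Q * y 1 ^ 2 ≤ 2 * E) (hy2 : Q * y 2 ^ 2 ≤ 2 * E)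
    (hF : ∀ i, 2 * F i ^ 2 ≤ Q * M ^ 2) :
    F 0 * y 0 + F 1 * y 1 + F 2 * y 2 ≤ 3 * M * Real.sqrt E := by
  have h0 := forcing_le hQ hM hy0 (hF 0)
  have h1 := forcing_le hQ hM hy1 (hF 1)
  have h2 := forcing_le hQ hM hy2 (hF 2)
  linarith

/-- Type-I bound of a pure quadratic term: `-(P S) ≤ L P` for `P ≥ 0`, `|S| ≤ L`. -/
private lemma quad_le {P S L : ℝ} (hP : 0 ≤ P) (hS : |S| ≤ L) : -(P * S) ≤ L * P := by
  have h1 : -S ≤ L := (neg_le_abs S).trans hS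
  nlinarith [mul_le_mul_of_nonneg_left h1 hP]

/-- One entry of the convective bilinear term: `-(x y d) ≤ ε (x² + y²)/2` for `|d| ≤ ε`. -/
private lemma pair_le {ε x y d : ℝ} (hd : |d| ≤ ε) :
    -(x * (y * d)) ≤ ε * ((x ^ 2 + y ^ 2) / 2) := by
  obtain ⟨h1, h2⟩ := abs_le.1 hd
  nlinarith [mul_nonneg (sub_nonneg.2 h2) (sq_nonneg (x + y)),
    mul_nonneg (show (0 : ℝ) ≤ ε + d by linarith) (sq_nonneg (x - y))]

/-- The convective term `-ρ Σⱼ wⱼ Σᵢ wᵢ ∂ᵢu₁ⱼ` is Type I: `≤ 6 ε E`. -/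
private lemma convective_le {ρ ε E : ℝ} {w : Fin 3 → ℝ} {du : Fin 3 → Fin 3 → ℝ} (hρ : 0 ≤ ρ)
    (hdu : ∀ i j, |du i j| ≤ ε) (hEw : ρ * (w 0 ^ 2 + w 1 ^ 2 + w 2 ^ 2) ≤ 2 * E) :
    -(ρ * (w 0 * (w 0 * du 0 0 + w 1 * du 1 0 + w 2 * du 2 0)
        + w 1 * (w 0 * du 0 1 + w 1 * du 1 1 + w 2 * du 2 1)
        + w 2 * (w 0 * du 0 2 + w 1 * du 1 2 + w 2 * du 2 2))) ≤ 6 * ε * E := by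
  have h00 := pair_le (x := w 0) (y := w 0) (hdu 0 0)
  have h10 := pair_le (x := w 0) (y := w 1) (hdu 1 0)
  have h20 := pair_le (x := w 0) (y := w 2) (hdu 2 0)
  have h01 := pair_le (x := w 1) (y := w 0) (hdu 0 1)
  have h11 := pair_le (x := w 1) (y := w 1) (hdu 1 1)
  have h21 := pair_le (x := w 1) (y := w 2) (hdu 2 1)
  have h02 := pair_le (x := w 2) (y := w 0) (hdu 0 2)
  have h12 := pair_le (x := w 2) (y := w 1) (hdu 1 2)
  have h22 := pair_le (x := w 2) (y := w 2) (hdu 2 2)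
  have hsum : -(w 0 * (w 0 * du 0 0 + w 1 * du 1 0 + w 2 * du 2 0)
        + w 1 * (w 0 * du 0 1 + w 1 * du 1 1 + w 2 * du 2 1)
        + w 2 * (w 0 * du 0 2 + w 1 * du 1 2 + w 2 * du 2 2))
      ≤ 3 * ε * (w 0 ^ 2 + w 1 ^ 2 + w 2 ^ 2) := by
    linarith
  have hε : 0 ≤ ε := (abs_nonneg _).trans (hdu 0 0)
  have h1 := mul_le_mul_of_nonneg_left hsum hρ
  have h2 := mul_le_mul_of_nonneg_left hEw (by positivity : (0 : ℝ) ≤ 3 * ε)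
  linarith

/-- The `a–w` cross terms `3c₁ (K − c₁A) dcᵢ · a wᵢ`: Type I. -/
private lemma crossA_le {K ε c₁ ρ A E a : ℝ} {dc w : Fin 3 → ℝ} (hK : 0 < K) (hε : 0 ≤ ε)
    (hc₁ : 0 < c₁) (hρlo : c₁ ^ 3 / 2 ≤ ρ) (hApos : 0 < A) (hAc : A * c₁ ≤ 15 * K / 4)
    (hAρlo : 3 * (K * c₁ ^ 2) / 8 ≤ A * ρ) (hdc2 : ∀ i, dc i ^ 2 ≤ ε ^ 2)
    (hEa : A * a ^ 2 ≤ 2 * E) (hEaw : A * a ^ 2 + ρ * (w 0 ^ 2 + w 1 ^ 2 + w 2 ^ 2) ≤ 2 * E) :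
    3 * c₁ * (K - c₁ * A) * dc 0 * a * w 0 + 3 * c₁ * (K - c₁ * A) * dc 1 * a * w 1
      + 3 * c₁ * (K - c₁ * A) * dc 2 * a * w 2 ≤ 42 * (K + 1) * ε * E := by
  have hρ : 0 < ρ := lt_of_lt_of_le (by positivity) hρlo
  have hsq : (K - c₁ * A) ^ 2 ≤ 2 * K ^ 2 + 2 * (c₁ * A) ^ 2 := by
    nlinarith [sq_nonneg (K + c₁ * A)]
  have h83 : K * c₁ ^ 2 ≤ 8 / 3 * (A * ρ) := by linarith
  have h2ρ : c₁ ^ 3 ≤ 2 * ρ := by linarith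
  have hκ : ∀ i, (3 * c₁ * (K - c₁ * A) * dc i) ^ 2 ≤ (14 * (K + 1) * ε) ^ 2 * A * ρ := by
    intro i
    have hd := hdc2 i
    calc (3 * c₁ * (K - c₁ * A) * dc i) ^ 2 = 9 * c₁ ^ 2 * (K - c₁ * A) ^ 2 * dc i ^ 2 := by ring
      _ ≤ 9 * c₁ ^ 2 * (2 * K ^ 2 + 2 * (c₁ * A) ^ 2) * ε ^ 2 := by gcongr
      _ = 18 * K * (K * c₁ ^ 2) * ε ^ 2 + 18 * c₁ ^ 3 * A * (A * c₁) * ε ^ 2 := by ring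
      _ ≤ 18 * K * (8 / 3 * (A * ρ)) * ε ^ 2 + 18 * (2 * ρ) * A * (15 * K / 4) * ε ^ 2 := by
          gcongr
      _ ≤ (14 * (K + 1) * ε) ^ 2 * A * ρ := by
          have : 0 ≤ ε ^ 2 * A * ρ * (196 * K ^ 2 + 209 * K + 196) := by positivity
          linarith
  have h := cross_sum_le (κ := fun i => 3 * c₁ * (K - c₁ * A) * dc i) hApos hρ (by positivity)
    hκ hEa hEaw
  linarith

/-- The `b–w` cross terms `−(3c₁²γ + 2Kc₁B) dcᵢ · b wᵢ`: Type I. -/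
private lemma crossB_le {K ε c₁ ρ γ B E b : ℝ} {dc w : Fin 3 → ℝ} (hK : 0 < K) (hε : 0 ≤ ε)
    (hc₁ : 0 < c₁) (hρlo : c₁ ^ 3 / 2 ≤ ρ) (hBpos : 0 < B) (hBK1 : ρ ≤ B * (K * c₁ ^ 2))
    (hBK2 : B * (K * c₁ ^ 2) ≤ 3 * ρ) (hγ : 0 ≤ γ) (hγhi : γ ≤ 5 / 4)
    (hdc2 : ∀ i, dc i ^ 2 ≤ ε ^ 2) (hEb : B * b ^ 2 ≤ 2 * E)
    (hEbw : B * b ^ 2 + ρ * (w 0 ^ 2 + w 1 ^ 2 + w 2 ^ 2) ≤ 2 * E) :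
    -((3 * c₁ ^ 2 * γ + 2 * K * c₁ * B) * dc 0) * b * w 0
      + -((3 * c₁ ^ 2 * γ + 2 * K * c₁ * B) * dc 1) * b * w 1
      + -((3 * c₁ ^ 2 * γ + 2 * K * c₁ * B) * dc 2) * b * w 2 ≤ 36 * (K + 1) * ε * E := by
  have hρ : 0 < ρ := lt_of_lt_of_le (by positivity) hρlo
  have hKc : 0 < K * c₁ ^ 2 := by positivity
  have hsq : (3 * c₁ ^ 2 * γ + 2 * K * c₁ * B) ^ 2
      ≤ 2 * (3 * c₁ ^ 2 * γ) ^ 2 + 2 * (2 * K * c₁ * B) ^ 2 := by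
    nlinarith [sq_nonneg (3 * c₁ ^ 2 * γ - 2 * K * c₁ * B)]
  have h2ρ : c₁ ^ 3 ≤ 2 * ρ := by linarith
  have h6 : c₁ ^ 3 * c₁ ^ 3 ≤ (2 * ρ) * (2 * ρ) := by gcongr
  have hγ2 : γ ^ 2 ≤ (5 / 4) ^ 2 := by gcongr
  have hκ : ∀ i, (-((3 * c₁ ^ 2 * γ + 2 * K * c₁ * B) * dc i)) ^ 2
      ≤ (12 * (K + 1) * ε) ^ 2 * B * ρ := by
    intro i
    have hd := hdc2 i
    refine le_of_mul_le_mul_right ?_ hKc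
    calc (-((3 * c₁ ^ 2 * γ + 2 * K * c₁ * B) * dc i)) ^ 2 * (K * c₁ ^ 2)
        = (3 * c₁ ^ 2 * γ + 2 * K * c₁ * B) ^ 2 * dc i ^ 2 * (K * c₁ ^ 2) := by ring
      _ ≤ (2 * (3 * c₁ ^ 2 * γ) ^ 2 + 2 * (2 * K * c₁ * B) ^ 2) * ε ^ 2 * (K * c₁ ^ 2) := by
          gcongr
      _ = 18 * K * γ ^ 2 * ε ^ 2 * (c₁ ^ 3 * c₁ ^ 3)
          + 8 * K ^ 2 * ε ^ 2 * c₁ ^ 2 * B * (B * (K * c₁ ^ 2)) := by ring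
      _ ≤ 18 * K * (5 / 4) ^ 2 * ε ^ 2 * ((2 * ρ) * (2 * ρ))
          + 8 * K ^ 2 * ε ^ 2 * c₁ ^ 2 * B * (3 * ρ) := by gcongr
      _ = 72 * K * (5 / 4) ^ 2 * ε ^ 2 * ρ * ρ + 24 * K ^ 2 * ε ^ 2 * c₁ ^ 2 * B * ρ := by ring
      _ ≤ 72 * K * (5 / 4) ^ 2 * ε ^ 2 * ρ * (B * (K * c₁ ^ 2))
          + 24 * K ^ 2 * ε ^ 2 * c₁ ^ 2 * B * ρ := by gcongr
      _ ≤ (12 * (K + 1) * ε) ^ 2 * B * ρ * (K * c₁ ^ 2) := by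
          have : 0 ≤ K * c₁ ^ 2 * ε ^ 2 * B * ρ * (288 * K ^ 2 + 303 * K + 288) := by
            positivity
          linarith
  have h := cross_sum_le (κ := fun i => -((3 * c₁ ^ 2 * γ + 2 * K * c₁ * B) * dc i)) hBpos hρ
    (by positivity) hκ hEb hEbw
  linarith

/-- The `w`-forcings `−(3Kc₁⁴(γ − 1) + 2Kc₁ρ z) dcᵢ · wᵢ` (`z = ζ0 − 1`): `σ³`-small. -/
private lemma forcingW_le {K cZ ε c₁ ρ γ z s3 E : ℝ} {dc w : Fin 3 → ℝ} (hK : 0 < K)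
    (hcZ : 0 ≤ cZ) (hε : 0 ≤ ε) (hc₁ : 0 < c₁) (hs3 : 0 ≤ s3) (hρ : 0 < ρ)
    (hρhi : ρ ≤ 3 * c₁ ^ 3 / 2) (hgsq : (γ - 1) ^ 2 ≤ (2 * (cZ * (ρ * s3))) ^ 2)
    (hzsq : z ^ 2 ≤ (cZ * (ρ * s3)) ^ 2) (hdc2 : ∀ i, dc i ^ 2 ≤ ε ^ 2)
    (hpow : c₁ ^ 11 ≤ (1 + c₁) ^ 16)
    (hEw0 : ρ * w 0 ^ 2 ≤ 2 * E) (hEw1 : ρ * w 1 ^ 2 ≤ 2 * E) (hEw2 : ρ * w 2 ^ 2 ≤ 2 * E) :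
    -((3 * K * c₁ ^ 4 * (γ - 1) + 2 * K * c₁ * ρ * z) * dc 0) * w 0
      + -((3 * K * c₁ ^ 4 * (γ - 1) + 2 * K * c₁ * ρ * z) * dc 1) * w 1
      + -((3 * K * c₁ ^ 4 * (γ - 1) + 2 * K * c₁ * ρ * z) * dc 2) * w 2
      ≤ 51 * K * cZ * s3 * (1 + c₁) ^ 8 * ε * Real.sqrt E := by
  have hM : 0 ≤ 17 * K * cZ * s3 * (1 + c₁) ^ 8 * ε := by positivity
  have hρ3 : ρ ^ 3 ≤ (3 * c₁ ^ 3 / 2) ^ 3 := by gcongr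
  have hsq : (3 * K * c₁ ^ 4 * (γ - 1) + 2 * K * c₁ * ρ * z) ^ 2
      ≤ 2 * (3 * K * c₁ ^ 4 * (γ - 1)) ^ 2 + 2 * (2 * K * c₁ * ρ * z) ^ 2 := by
    nlinarith [sq_nonneg (3 * K * c₁ ^ 4 * (γ - 1) - 2 * K * c₁ * ρ * z)]
  have hF : ∀ i, 2 * (-((3 * K * c₁ ^ 4 * (γ - 1) + 2 * K * c₁ * ρ * z) * dc i)) ^ 2
      ≤ ρ * (17 * K * cZ * s3 * (1 + c₁) ^ 8 * ε) ^ 2 := by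
    intro i
    have hd := hdc2 i
    calc 2 * (-((3 * K * c₁ ^ 4 * (γ - 1) + 2 * K * c₁ * ρ * z) * dc i)) ^ 2
        = 2 * (3 * K * c₁ ^ 4 * (γ - 1) + 2 * K * c₁ * ρ * z) ^ 2 * dc i ^ 2 := by ring
      _ ≤ 2 * (2 * (3 * K * c₁ ^ 4 * (γ - 1)) ^ 2 + 2 * (2 * K * c₁ * ρ * z) ^ 2) * ε ^ 2 := by
          gcongr
      _ = (36 * K ^ 2 * c₁ ^ 8 * (γ - 1) ^ 2 + 16 * K ^ 2 * c₁ ^ 2 * ρ ^ 2 * z ^ 2) * ε ^ 2 := by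
          ring
      _ ≤ (36 * K ^ 2 * c₁ ^ 8 * (2 * (cZ * (ρ * s3))) ^ 2
          + 16 * K ^ 2 * c₁ ^ 2 * ρ ^ 2 * (cZ * (ρ * s3)) ^ 2) * ε ^ 2 := by gcongr
      _ = K ^ 2 * cZ ^ 2 * s3 ^ 2 * ε ^ 2 * (144 * c₁ ^ 8 * ρ + 16 * c₁ ^ 2 * ρ ^ 3) * ρ := by
          ring
      _ ≤ K ^ 2 * cZ ^ 2 * s3 ^ 2 * ε ^ 2
          * (144 * c₁ ^ 8 * (3 * c₁ ^ 3 / 2) + 16 * c₁ ^ 2 * (3 * c₁ ^ 3 / 2) ^ 3) * ρ := by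
          gcongr
      _ = 270 * (K ^ 2 * cZ ^ 2 * s3 ^ 2 * ε ^ 2) * c₁ ^ 11 * ρ := by ring
      _ ≤ 289 * (K ^ 2 * cZ ^ 2 * s3 ^ 2 * ε ^ 2) * (1 + c₁) ^ 16 * ρ := by gcongr; norm_num
      _ = ρ * (17 * K * cZ * s3 * (1 + c₁) ^ 8 * ε) ^ 2 := by ring
  have h := forcing_sum_le hρ hM hEw0 hEw1 hEw2
    (F := fun i => -((3 * K * c₁ ^ 4 * (γ - 1) + 2 * K * c₁ * ρ * z) * dc i)) hF
  linarith

/-- The forcing `−ρ (ζ0 − 1) b · div u₁` from the temperature equation: `σ³`-small. -/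
private lemma forcingT_le {K cZ ε c₁ ρ z s3 B E b S : ℝ} (hK : 0 < K)
    (hcZ : 0 ≤ cZ) (hε : 0 ≤ ε) (hc₁ : 0 < c₁) (hs3 : 0 ≤ s3) (hρ : 0 < ρ)
    (hρhi : ρ ≤ 3 * c₁ ^ 3 / 2) (hBpos : 0 < B) (hBK1 : ρ ≤ B * (K * c₁ ^ 2))
    (hzsq : z ^ 2 ≤ (cZ * (ρ * s3)) ^ 2) (hS2 : S ^ 2 ≤ (3 * ε) ^ 2)
    (hpow : c₁ ^ 11 ≤ (1 + c₁) ^ 16) (hEb : B * b ^ 2 ≤ 2 * E) :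
    (-(ρ * z * S)) * b ≤ 8 * cZ * (K + 1) * s3 * (1 + c₁) ^ 8 * ε * Real.sqrt E := by
  have hM : 0 ≤ 8 * cZ * (K + 1) * s3 * (1 + c₁) ^ 8 * ε := by positivity
  have hKc : 0 < K * c₁ ^ 2 := by positivity
  have hK1 : K ≤ (K + 1) ^ 2 := by nlinarith [sq_nonneg (K + 1 / 2)]
  have hρ3 : ρ ^ 3 ≤ (3 * c₁ ^ 3 / 2) ^ 3 := by gcongr
  have hF : 2 * (-(ρ * z * S)) ^ 2 ≤ B * (8 * cZ * (K + 1) * s3 * (1 + c₁) ^ 8 * ε) ^ 2 := by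
    refine le_of_mul_le_mul_right ?_ hKc
    calc 2 * (-(ρ * z * S)) ^ 2 * (K * c₁ ^ 2)
        = 2 * K * c₁ ^ 2 * ρ ^ 2 * z ^ 2 * S ^ 2 := by ring
      _ ≤ 2 * K * c₁ ^ 2 * ρ ^ 2 * (cZ * (ρ * s3)) ^ 2 * (3 * ε) ^ 2 := by gcongr
      _ = 18 * K * cZ ^ 2 * s3 ^ 2 * ε ^ 2 * c₁ ^ 2 * ρ ^ 3 * ρ := by ring
      _ ≤ 18 * K * cZ ^ 2 * s3 ^ 2 * ε ^ 2 * c₁ ^ 2 * (3 * c₁ ^ 3 / 2) ^ 3 * ρ := by gcongr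
      _ = 243 / 4 * K * (cZ ^ 2 * s3 ^ 2 * ε ^ 2) * c₁ ^ 11 * ρ := by ring
      _ ≤ 64 * (K + 1) ^ 2 * (cZ ^ 2 * s3 ^ 2 * ε ^ 2) * (1 + c₁) ^ 16 * ρ := by
          gcongr; norm_num
      _ = (8 * cZ * (K + 1) * s3 * (1 + c₁) ^ 8 * ε) ^ 2 * ρ := by ring
      _ ≤ (8 * cZ * (K + 1) * s3 * (1 + c₁) ^ 8 * ε) ^ 2 * (B * (K * c₁ ^ 2)) := by gcongr
      _ = B * (8 * cZ * (K + 1) * s3 * (1 + c₁) ^ 8 * ε) ^ 2 * (K * c₁ ^ 2) := by ring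
  exact forcing_le hBpos hM hEb hF

/-- The level-0 pairing estimate with the algebra done, in terms of the weights `A = θ(ζ0+ζ1)/ρ`,
`B = 3ρ/(2θ)`, the energy `E` and the derivative scale `ε = C/λ`. -/
private theorem main_bound (K cZ ε c₁ ρ θ ζ0 ζ1 s3 a b A B E : ℝ)
    (du : Fin 3 → Fin 3 → ℝ) (dc : Fin 3 → ℝ) (w : Fin 3 → ℝ)
    (hK : 0 < K) (hcZ : 0 ≤ cZ) (hε : 0 ≤ ε) (hc₁ : 0 < c₁) (hs3 : 0 ≤ s3)
    (hpack : ρ * s3 * (cZ + 1) ≤ 1 / 8) (hζ0 : |ζ0 - 1| ≤ cZ * (ρ * s3))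
    (hζ1 : |ζ1| ≤ cZ * (ρ * s3))
    (ha : a = ρ - c₁ ^ 3) (hb : b = θ - K * c₁ ^ 2) (haabs : |a| ≤ c₁ ^ 3 / 2)
    (hbabs : |b| ≤ K * c₁ ^ 2 / 2) (hdu : ∀ i j, |du i j| ≤ ε) (hdc : ∀ i, |dc i| ≤ ε)
    (hA : A = θ * (ζ0 + ζ1) / ρ) (hB : B = 3 / 2 * ρ / θ)
    (hE : E = 1 / 2 * (A * a ^ 2 + ρ * (w 0 ^ 2 + w 1 ^ 2 + w 2 ^ 2) + B * b ^ 2)) :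
    -(A * a ^ 2 * (du 0 0 + du 1 1 + du 2 2))
      - 3 * c₁ ^ 2 * A * a * (w 0 * dc 0 + w 1 * dc 1 + w 2 * dc 2)
      - ρ * (w 0 * (w 0 * du 0 0 + w 1 * du 1 0 + w 2 * du 2 0)
          + w 1 * (w 0 * du 0 1 + w 1 * du 1 1 + w 2 * du 2 1)
          + w 2 * (w 0 * du 0 2 + w 1 * du 1 2 + w 2 * du 2 2))
      - 3 * c₁ * (c₁ * θ * (ζ0 + ζ1) - K * ρ) * (w 0 * dc 0 + w 1 * dc 1 + w 2 * dc 2)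
      - 2 * K * c₁ * ρ * (ζ0 - 1) * (w 0 * dc 0 + w 1 * dc 1 + w 2 * dc 2)
      - 2 * K * c₁ * B * b * (w 0 * dc 0 + w 1 * dc 1 + w 2 * dc 2)
      - 2 / 3 * B * b ^ 2 * (du 0 0 + du 1 1 + du 2 2)
      - ρ * (ζ0 - 1) * b * (du 0 0 + du 1 1 + du 2 2)
      ≤ (94 + 78 * K) * ε * E + cZ * (59 * K + 8) * ε * s3 * (1 + c₁) ^ 8 * Real.sqrt E := by
  obtain ⟨ha1, ha2⟩ := abs_le.1 haabs
  obtain ⟨hb1, hb2⟩ := abs_le.1 hbabs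
  obtain ⟨hz1, hz2⟩ := abs_le.1 hζ0
  obtain ⟨hy1, hy2⟩ := abs_le.1 hζ1
  have hc2 : 0 < c₁ ^ 2 := by positivity
  have hc3 : 0 < c₁ ^ 3 := by positivity
  have hρlo : c₁ ^ 3 / 2 ≤ ρ := by linarith
  have hρhi : ρ ≤ 3 * c₁ ^ 3 / 2 := by linarith
  have hθlo : K * c₁ ^ 2 / 2 ≤ θ := by linarith
  have hθhi : θ ≤ 3 * (K * c₁ ^ 2) / 2 := by linarith
  have hρ : 0 < ρ := by linarith
  have hθ : 0 < θ := by nlinarith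
  have hηcZ : cZ * (ρ * s3) ≤ 1 / 8 := by linarith [mul_nonneg hρ.le hs3]
  have hγlo : 3 / 4 ≤ ζ0 + ζ1 := by linarith
  have hγhi : ζ0 + ζ1 ≤ 5 / 4 := by linarith
  have hγ : 0 < ζ0 + ζ1 := by linarith
  have hApos : 0 < A := by rw [hA]; positivity
  have hBpos : 0 < B := by rw [hB]; positivity
  have hAρ : A * ρ = θ * (ζ0 + ζ1) := by rw [hA]; field_simp
  have hBθ : B * θ = 3 / 2 * ρ := by rw [hB]; field_simp
  have hAρlo : 3 * (K * c₁ ^ 2) / 8 ≤ A * ρ := by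
    have := mul_le_mul hθlo hγlo (by norm_num) hθ.le
    rw [hAρ]; linarith
  have hAc : A * c₁ ≤ 15 * K / 4 := by
    have h0 := mul_le_mul hθhi hγhi hγ.le (by positivity)
    have h1 : A * (c₁ ^ 3 / 2) ≤ A * ρ := mul_le_mul_of_nonneg_left hρlo hApos.le
    have h2 : A * c₁ * c₁ ^ 2 ≤ 15 * K / 4 * c₁ ^ 2 := by rw [hAρ] at h1; linarith
    exact le_of_mul_le_mul_right h2 hc2
  have hBK1 : ρ ≤ B * (K * c₁ ^ 2) := by
    have := mul_le_mul_of_nonneg_left hθhi hBpos.le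
    linarith
  have hBK2 : B * (K * c₁ ^ 2) ≤ 3 * ρ := by
    have := mul_le_mul_of_nonneg_left hθlo hBpos.le
    linarith
  have pa : 0 ≤ A * a ^ 2 := by positivity
  have pw0 : 0 ≤ ρ * w 0 ^ 2 := by positivity
  have pw1 : 0 ≤ ρ * w 1 ^ 2 := by positivity
  have pw2 : 0 ≤ ρ * w 2 ^ 2 := by positivity
  have pb : 0 ≤ B * b ^ 2 := by positivity
  have hEa : A * a ^ 2 ≤ 2 * E := by rw [hE]; linarith
  have hEb : B * b ^ 2 ≤ 2 * E := by rw [hE]; linarith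
  have hEw0 : ρ * w 0 ^ 2 ≤ 2 * E := by rw [hE]; linarith
  have hEw1 : ρ * w 1 ^ 2 ≤ 2 * E := by rw [hE]; linarith
  have hEw2 : ρ * w 2 ^ 2 ≤ 2 * E := by rw [hE]; linarith
  have hEaw : A * a ^ 2 + ρ * (w 0 ^ 2 + w 1 ^ 2 + w 2 ^ 2) ≤ 2 * E := by rw [hE]; linarith
  have hEbw : B * b ^ 2 + ρ * (w 0 ^ 2 + w 1 ^ 2 + w 2 ^ 2) ≤ 2 * E := by rw [hE]; linarith
  have hEws : ρ * (w 0 ^ 2 + w 1 ^ 2 + w 2 ^ 2) ≤ 2 * E := by rw [hE]; linarith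
  have hdc2 : ∀ i, dc i ^ 2 ≤ ε ^ 2 := fun i => by
    have h := abs_le.1 (hdc i); exact sq_le_sq' h.1 h.2
  have hSabs : |du 0 0 + du 1 1 + du 2 2| ≤ 3 * ε := by
    calc |du 0 0 + du 1 1 + du 2 2| ≤ |du 0 0| + |du 1 1| + |du 2 2| := abs_add_three _ _ _
      _ ≤ ε + ε + ε := by gcongr <;> exact hdu _ _
      _ = 3 * ε := by ring
  have hS2 : (du 0 0 + du 1 1 + du 2 2) ^ 2 ≤ (3 * ε) ^ 2 := by
    have h := abs_le.1 hSabs; exact sq_le_sq' h.1 h.2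
  have hzsq : (ζ0 - 1) ^ 2 ≤ (cZ * (ρ * s3)) ^ 2 := sq_le_sq' hz1 hz2
  have hgsq : (ζ0 + ζ1 - 1) ^ 2 ≤ (2 * (cZ * (ρ * s3))) ^ 2 :=
    sq_le_sq' (by linarith) (by linarith)
  have hpow : c₁ ^ 11 ≤ (1 + c₁) ^ 16 := by
    calc c₁ ^ 11 ≤ (1 + c₁) ^ 11 := by gcongr; linarith
      _ ≤ (1 + c₁) ^ 16 := pow_le_pow_right₀ (by linarith) (by norm_num)
  have hT1 : -(A * a ^ 2 * (du 0 0 + du 1 1 + du 2 2)) ≤ 6 * ε * E := by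
    linarith [quad_le pa hSabs, mul_le_mul_of_nonneg_left hEa (by positivity : (0 : ℝ) ≤ 3 * ε)]
  have hT2 : -(2 / 3 * B * b ^ 2 * (du 0 0 + du 1 1 + du 2 2)) ≤ 4 * ε * E := by
    linarith [quad_le (P := 2 / 3 * B * b ^ 2) (by positivity) hSabs,
      mul_le_mul_of_nonneg_left hEb (by positivity : (0 : ℝ) ≤ 2 * ε)]
  have hT3 := convective_le (E := E) hρ.le hdu hEws
  have hT4 := crossA_le (a := a) hK hε hc₁ hρlo hApos hAc hAρlo hdc2 hEa hEaw
  have hT5 := crossB_le (b := b) hK hε hc₁ hρlo hBpos hBK1 hBK2 hγ.le hγhi hdc2 hEb hEbw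
  have hT6 := forcingW_le (K := K) hK hcZ hε hc₁ hs3 hρ hρhi hgsq hzsq hdc2 hpow hEw0 hEw1 hEw2
  have hT7 := forcingT_le hK hcZ hε hc₁ hs3 hρ hρhi hBpos hBK1 hzsq hS2 hpow hEb
  linear_combination hT1 + hT2 + hT3 + hT4 + hT5 + hT6 + hT7
    + (-(3 * K * c₁ * (w 0 * dc 0 + w 1 * dc 1 + w 2 * dc 2))) * ha
    + (3 * c₁ ^ 2 * (ζ0 + ζ1) * (w 0 * dc 0 + w 1 * dc 1 + w 2 * dc 2)) * hb

/-- **Level-0 pairing bound** (helper toward `stub_logBudgetShadowing`, line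
`log-lipschitz-budget`). For `K > 0`, `C, c_Z ≥ 0` there are `Λ, Γ ≥ 0` (we take
`Λ = C (94 + 78K)`, `Γ = C c_Z (59K + 8)`) such that at every point, with `a = ρ − c₁³`,
`b = θ − Kc₁²`, `|a| ≤ c₁³/2`, `|b| ≤ Kc₁²/2`, Type-I reference gradients `|du₁|, |dc₁| ≤ C/λ`,
and equation-of-state values `|ζ0 − 1|, |ζ1| ≤ c_Z ρ σ³` in the packing regime
`ρσ³(c_Z + 1) ≤ 1/8`, the pairing of `(A a, ρ w, B b)` (`A = θ(ζ0+ζ1)/ρ`, `B = 3ρ/(2θ)`) with the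
right-hand sides of the difference system is at most
`(Λ/λ) e + Γ σ³ (1 + c₁)⁸ / λ · √e`, where `e = ½ (A a² + ρ Σ wᵢ² + B b²)`. -/
theorem level0_pairing_pointwise_bound : ∀ (K C cZ : ℝ), 0 < K → 0 ≤ C → 0 ≤ cZ →
    ∃ Λ Γ : ℝ, 0 ≤ Λ ∧ 0 ≤ Γ ∧ ∀ (lam c₁ ρ θ ζ0 ζ1 s3 : ℝ) (du₁ : Fin 3 → Fin 3 → ℝ)
    (dc₁ : Fin 3 → ℝ) (a b : ℝ) (w : Fin 3 → ℝ), 0 < lam → 0 < c₁ → 0 ≤ s3 →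
    ρ * s3 * (cZ + 1) ≤ 1 / 8 → |ζ0 - 1| ≤ cZ * (ρ * s3) → |ζ1| ≤ cZ * (ρ * s3) →
    a = ρ - c₁ ^ 3 → b = θ - K * c₁ ^ 2 → |a| ≤ c₁ ^ 3 / 2 → |b| ≤ K * c₁ ^ 2 / 2 →
    (∀ i j, |du₁ i j| ≤ C / lam) → (∀ i, |dc₁ i| ≤ C / lam) →
    θ * (ζ0 + ζ1) / ρ * a * (-(a * ∑ i, du₁ i i) - ∑ i, w i * (3 * c₁ ^ 2 * dc₁ i)) +
    ρ * ∑ j, w j * (-(∑ i, w i * du₁ i j) -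
      (θ * (ζ0 + ζ1) / ρ - K * c₁ ^ 2 * 1 / c₁ ^ 3) * (3 * c₁ ^ 2 * dc₁ j) -
      (ζ0 - 1) * (2 * K * c₁ * dc₁ j)) +
    3 / 2 * ρ / θ * b * (-(∑ i, w i * (2 * K * c₁ * dc₁ i)) -
      2 / 3 * (θ * ζ0 - K * c₁ ^ 2 * 1) * ∑ i, du₁ i i) ≤
    Λ / lam * (1 / 2 * (θ * (ζ0 + ζ1) / ρ * a ^ 2 + ρ * ∑ i, w i ^ 2 + 3 / 2 * ρ / θ * b ^ 2)) +
    Γ * s3 * (1 + c₁) ^ 8 / lam * Real.sqrt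
      (1 / 2 * (θ * (ζ0 + ζ1) / ρ * a ^ 2 + ρ * ∑ i, w i ^ 2 + 3 / 2 * ρ / θ * b ^ 2)) := by
  intro K C cZ hK hC hcZ
  refine ⟨C * (94 + 78 * K), C * cZ * (59 * K + 8), by positivity, by positivity, ?_⟩
  intro lam c₁ ρ θ ζ0 ζ1 s3 du₁ dc₁ a b w hlam hc₁ hs3 hpack hζ0 hζ1 ha hb haabs hbabs hdu hdc
  simp only [Fin.sum_univ_three]
  obtain ⟨⟨ha1, ha2⟩, hb1, hb2⟩ := And.intro (abs_le.1 haabs) (abs_le.1 hbabs)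
  have hc3 : 0 < c₁ ^ 3 := by positivity
  have hKc : 0 < K * c₁ ^ 2 := by positivity
  have hρ : 0 < ρ := by linarith
  have hθ : 0 < θ := by linarith
  have hρne : ρ ≠ 0 := hρ.ne'
  have hc₁ne : c₁ ≠ 0 := hc₁.ne'
  have key := main_bound K cZ (C / lam) c₁ ρ θ ζ0 ζ1 s3 a b (θ * (ζ0 + ζ1) / ρ) (3 / 2 * ρ / θ)
    (1 / 2 * (θ * (ζ0 + ζ1) / ρ * a ^ 2 + ρ * (w 0 ^ 2 + w 1 ^ 2 + w 2 ^ 2)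
      + 3 / 2 * ρ / θ * b ^ 2))
    du₁ dc₁ w hK hcZ (by positivity) hc₁ hs3 hpack hζ0 hζ1 ha hb haabs hbabs hdu hdc rfl rfl rfl
  have id1 : ρ * (θ * (ζ0 + ζ1) / ρ - K * c₁ ^ 2 * 1 / c₁ ^ 3) * (3 * c₁ ^ 2)
      = 3 * c₁ * (c₁ * θ * (ζ0 + ζ1) - K * ρ) := by
    field_simp
  have id2 : 3 / 2 * ρ / θ * θ = 3 / 2 * ρ := div_mul_cancel₀ _ hθ.ne'
  refine Eq.trans_le ?_ (key.trans_eq ?_)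
  · linear_combination (-(w 0 * dc₁ 0 + w 1 * dc₁ 1 + w 2 * dc₁ 2)) * id1
      + (-(2 / 3) * b * (du₁ 0 0 + du₁ 1 1 + du₁ 2 2) * (ζ0 - 1)) * id2
      + (2 / 3 * (3 / 2 * ρ / θ) * b * (du₁ 0 0 + du₁ 1 1 + du₁ 2 2)) * hb
  · ring

end Summit.AtomisticToContinuum.HydrodynamicLimit.Theorems
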